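import Summits.KontsevichZagierPeriods.KontsevichZagierPeriods.Theorems.LiouvilleUnfoldingAyoubPiCancellationStubStripConst
import Mathlib.Analysis.SpecialFunctions.Sqrt

/-!
# Crux stmt-KontsevichZagierPeriods-0540 (`LiouvilleUnfolding.AyoubPiCancellation` ≡ `KZ.PiCancellation`),
# line `Sketch` (idea `moving-segment-wronskian`): stub `stub_spreadPlaneReduce`

Support file (`--supports` stmt-KontsevichZagierPeriods-0540) of the line skeleton (v6), registered
stub `stub_spreadPlaneReduce` (M). For an interior interval `-1 < a' < b' < 1` (rational) the PLANE
STAGE `K = [{(x, q) : -1 ≤ x ≤ q, a' ≤ q ≤ b'}, 2√(1 − x²) · w(q)]` (coordinates `z 0 = x`,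
`z 1 = q`) of a weight `w` which is, on `(a', b')`, the derivative of the profile primitive
`G(q) = (q − a')(q − b') / (2√(1 − q²))` (in the stub: the zero-mean spread weight
`h_{a',b'} = 𝟙_{(a',b')} · G'` of `stub_spreadWeight`) is equivalent in the Kontsevich–Zagier
calculus (`KZCalculus.lean`) to the SEGMENT STAGE `K_mid = [[a', b'], −(x − a')(x − b')]`
(dimension `1`). The chain of moves (`spreadPlaneReduce_of_hasDerivAt`):
* cut `K` at `x = a'` (printed rule (1), `KZ.domainAddRel`; the overlap lies in the null line
  `{x = a'}`, `MeasureTheory.Measure.pi_hyperplane`): `[K] − [K_L] − [K_R]` with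
  `K_L = K|{x ≤ a'}`, `K_R = K|{a' ≤ x}`;
* on the left piece `{-1 ≤ x ≤ a'} × [a', b']`, Newton–Leibniz along the last coordinate `q`
  (printed rule (3), `KZ.newtonLeibnizRel`) with constant edges `a' ≤ b'` and primitive
  `F (x, q) = 2√(1 − x²) · G(q)`: the boundary term `F (x, b') − F (x, a')` vanishes
  (`G(a') = G(b') = 0`), so `K_L ∼ [[-1, a'], 0]`, a relation (`KZ.of_mem_relations_of_eqOn_zero`);
* on the right piece `{(x, q) : a' ≤ x ≤ b', x ≤ q ≤ b'}`, Newton–Leibniz along `q` over the base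
  `[a', b']` with edges `x ≤ b'` and the same primitive: the boundary term is
  `F (x, b') − F (x, x) = −2√(1 − x²) · G(x) = −(x − a')(x − b')` — the chord length CANCELS the
  profile on the diagonal `q = x` — so `K_R ∼ K_mid`.
Calculus input (`spreadPlaneReduce_hasDerivAt_profile`):
`G'(t) = ((2t − (a' + b'))(1 − t²) + t (t − a')(t − b')) / (2 (1 − t²) √(1 − t²))` on `(a', b')`.
No definitions; namespace of the line skeleton; the admissibility hypotheses of the stub on
`h_{a',b'}` are not needed here (the plane stage `K` carries its own admissibility).
References: M. Kontsevich, D. Zagier, *Periods* (2001), §1.2, rules (1), (3); J. Bochnak, M. Coste,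
M.-F. Roy, *Real Algebraic Geometry* (1998), §2.2 (Prop. 2.2.6).
-/

noncomputable section

-- `Summit.KontsevichZagierPeriods.KontsevichZagierPeriods.…` is the tree's mandated layout (single-conjunct summit).
set_option linter.dupNamespace false

namespace Summit.KontsevichZagierPeriods.KontsevichZagierPeriods.AyoubPiCancellationLine

open Set MeasureTheory
open Literature.NumberTheory.Transcendental
open Literature.NumberTheory.Transcendental.KZ
open Literature.ModelTheory.ExponentialFields (IsSemialgebraic isSemialgebraic_setOf_eval_le)
open MvPolynomial (X C)
open Summit.KontsevichZagierPeriods.CompleteModGammaSectorNegative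
  (isSemialgebraic_band isCompact_band)

-- adapted from Summits/KontsevichZagierPeriods/KontsevichZagierPeriods/Theorems/LiouvilleUnfoldingAyoubPiCancellationStubStripConst.lean

/-! ## Calculus of the profile primitive `G(q) = (q − a')(q − b') / (2√(1 − q²))` -/

/-- On the closed interior interval `[a', b'] ⊆ (-1, 1)` the radicand `1 − t²` is positive. [folklore] -/
theorem spreadPlaneReduce_radicand_pos {a' b' : ℚ} (ha : -1 < a') (hb : b' < 1) {t : ℝ}
    (hat : (a' : ℝ) ≤ t) (htb : t ≤ (b' : ℝ)) : 0 < 1 - t ^ 2 := by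
  have ha' : (-1 : ℝ) < (a' : ℝ) := by exact_mod_cast ha
  have hb' : ((b' : ℚ) : ℝ) < 1 := by exact_mod_cast hb
  nlinarith

/-- **The key calculus fact**: on `(a', b')` the profile primitive
`G(q) = (q − a')(q − b') / (2√(1 − q²))` has derivative
`G'(t) = ((2t − (a' + b'))(1 − t²) + t (t − a')(t − b')) / (2 (1 − t²) √(1 − t²))`
(quotient rule, `d/dt √(1 − t²) = −t / √(1 − t²)`). [folklore] -/
theorem spreadPlaneReduce_hasDerivAt_profile {a' b' : ℚ} (ha : -1 < a') (hb : b' < 1) {t : ℝ}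
    (ht : t ∈ Set.Ioo (a' : ℝ) b') :
    HasDerivAt (fun q : ℝ => (q - a') * (q - b') / (2 * Real.sqrt (1 - q ^ 2)))
      (((2 * t - (a' + b')) * (1 - t ^ 2) + t * ((t - a') * (t - b'))) /
        (2 * (1 - t ^ 2) * Real.sqrt (1 - t ^ 2))) t := by
  have hu : 0 < 1 - t ^ 2 := stripWeight_radicand_pos ha hb ht.1 ht.2
  have hs : 0 < Real.sqrt (1 - t ^ 2) := Real.sqrt_pos.2 hu
  have hN : HasDerivAt (fun q : ℝ => (q - a') * (q - b')) (1 * (t - b') + (t - a') * 1) t :=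
    ((hasDerivAt_id' t).sub_const (a' : ℝ)).fun_mul ((hasDerivAt_id' t).sub_const (b' : ℝ))
  have hR : HasDerivAt (fun q : ℝ => 1 - q ^ 2) (-(2 * t)) t := by
    simpa using (hasDerivAt_pow 2 t).const_sub (1 : ℝ)
  refine (hN.fun_div ((hR.sqrt hu.ne').const_mul 2)
    (mul_ne_zero two_ne_zero hs.ne')).congr_deriv ?_
  set s := Real.sqrt (1 - t ^ 2)
  have hu' : (1 : ℝ) - t ^ 2 = s ^ 2 := (Real.sq_sqrt hu.le).symm
  have hs0 : s ≠ 0 := hs.ne'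
  rw [hu']
  field_simp
  ring

/-- The fibre primitive `t ↦ c · G(t)` is continuous on every closed subinterval `[lo, b']` of
`[a', b']` (the denominator `2√(1 − t²)` does not vanish there). [folklore] -/
theorem spreadPlaneReduce_continuousOn_profile {a' b' : ℚ} (ha : -1 < a') (hb : b' < 1) (c : ℝ)
    {lo : ℝ} (hlo : (a' : ℝ) ≤ lo) :
    ContinuousOn (fun t : ℝ => c * ((t - a') * (t - b') / (2 * Real.sqrt (1 - t ^ 2))))
      (Icc lo b') := by
  refine continuousOn_const.mul (ContinuousOn.div (by fun_prop) (by fun_prop) fun t ht => ?_)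
  exact mul_ne_zero two_ne_zero
    (Real.sqrt_pos.2 (spreadPlaneReduce_radicand_pos ha hb (hlo.trans ht.1) ht.2)).ne'

/-! ## Semialgebraic sets and functions -/

/-- The left piece `{-1 ≤ x ≤ a'} × [a', b'] ⊆ ℝ²` of the plane stage is `ℚ`-semialgebraic.
[folklore] -/
theorem spreadPlaneReduce_isSemialgebraic_left (a' b' : ℚ) :
    IsSemialgebraic ℚ {z : Fin 2 → ℝ | (-1 ≤ z 0 ∧ z 0 ≤ a') ∧ ((a' : ℝ) ≤ z 1 ∧ z 1 ≤ b')} := by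
  have h1 : IsSemialgebraic ℚ {z : Fin 2 → ℝ | -1 ≤ z 0} := by
    simpa using isSemialgebraic_setOf_eval_le (k := ℚ) (R := ℝ) (-1) (X (0 : Fin 2))
  have h2 : IsSemialgebraic ℚ {z : Fin 2 → ℝ | z 0 ≤ (a' : ℝ)} := by
    simpa using isSemialgebraic_setOf_eval_le (k := ℚ) (R := ℝ) (X (0 : Fin 2)) (C a')
  have h3 : IsSemialgebraic ℚ {z : Fin 2 → ℝ | (a' : ℝ) ≤ z 1} := by
    simpa using isSemialgebraic_setOf_eval_le (k := ℚ) (R := ℝ) (C a') (X (1 : Fin 2))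
  have h4 : IsSemialgebraic ℚ {z : Fin 2 → ℝ | z 1 ≤ (b' : ℝ)} := by
    simpa using isSemialgebraic_setOf_eval_le (k := ℚ) (R := ℝ) (X (1 : Fin 2)) (C b')
  convert (h1.inter h2).inter (h3.inter h4) using 1
  ext z
  simp only [mem_inter_iff, mem_setOf_eq]

/-- The right piece `{(x, q) : a' ≤ x ≤ b', x ≤ q ≤ b'} ⊆ ℝ²` of the plane stage (the band
`{x ≤ q ≤ b'}` over `[a', b']`) is `ℚ`-semialgebraic. [folklore] -/
theorem spreadPlaneReduce_isSemialgebraic_right (a' b' : ℚ) :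
    IsSemialgebraic ℚ {z : Fin 2 → ℝ | ((a' : ℝ) ≤ z 0 ∧ z 0 ≤ b') ∧ z 0 ≤ z 1 ∧ z 1 ≤ b'} := by
  have h1 : IsSemialgebraic ℚ {z : Fin 2 → ℝ | (a' : ℝ) ≤ z 0} := by
    simpa using isSemialgebraic_setOf_eval_le (k := ℚ) (R := ℝ) (C a') (X (0 : Fin 2))
  have h2 : IsSemialgebraic ℚ {z : Fin 2 → ℝ | z 0 ≤ (b' : ℝ)} := by
    simpa using isSemialgebraic_setOf_eval_le (k := ℚ) (R := ℝ) (X (0 : Fin 2)) (C b')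
  have h3 : IsSemialgebraic ℚ {z : Fin 2 → ℝ | z 0 ≤ z 1} := by
    simpa using isSemialgebraic_setOf_eval_le (k := ℚ) (R := ℝ) (X (0 : Fin 2)) (X 1)
  have h4 : IsSemialgebraic ℚ {z : Fin 2 → ℝ | z 1 ≤ (b' : ℝ)} := by
    simpa using isSemialgebraic_setOf_eval_le (k := ℚ) (R := ℝ) (X (1 : Fin 2)) (C b')
  convert (h1.inter h2).inter (h3.inter h4) using 1
  ext z
  simp only [mem_inter_iff, mem_setOf_eq]

/-- The base `[-1, a'] ⊆ ℝ¹` of the left piece is `ℚ`-semialgebraic. [folklore] -/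
theorem spreadPlaneReduce_isSemialgebraic_leftBase (a' : ℚ) :
    IsSemialgebraic ℚ {x : Fin 1 → ℝ | -1 ≤ x 0 ∧ x 0 ≤ a'} := by
  simpa using isSemialgebraic_band (-1) a'

/-- The primitive `F (x, q) = 2√(1 − x²) · (q − a')(q − b') / (2√(1 − q²))` is `ℚ`-semialgebraic
on every `ℚ`-semialgebraic subset of the strip `{a' ≤ q ≤ b'} ⊆ ℝ²` of an interior interval:
products, square roots of polynomials and a quotient with non-vanishing denominator
(Tarski–Seidenberg). [cite: BochnakCosteRoy1998, Prop. 2.2.6] -/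
theorem spreadPlaneReduce_isSemialgebraicFunOn_prim {a' b' : ℚ} (ha : -1 < a') (hb : b' < 1)
    {s : Set (Fin 2 → ℝ)} (hs : IsSemialgebraic ℚ s)
    (hsub : ∀ z ∈ s, (a' : ℝ) ≤ z 1 ∧ z 1 ≤ b') :
    IsSemialgebraicFunOn ℚ s (fun z : Fin 2 → ℝ => 2 * Real.sqrt (1 - z 0 ^ 2) *
      ((z (Fin.last 1) - a') * (z (Fin.last 1) - b') /
        (2 * Real.sqrt (1 - z (Fin.last 1) ^ 2)))) := by
  have h1 : IsSemialgebraicFunOn ℚ s (fun z => 2 * Real.sqrt (1 - z 0 ^ 2)) :=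
    (IsSemialgebraicFunOn.mul_holds (isSemialgebraicFunOn_natCast hs 2)
      (IsSemialgebraicFunOn.sqrt_holds (isSemialgebraicFunOn_aeval hs
        (1 - X 0 ^ 2 : MvPolynomial (Fin 2) ℚ)))).congr fun z _ => by simp
  have h2 : IsSemialgebraicFunOn ℚ s
      (fun z => (z (Fin.last 1) - a') * (z (Fin.last 1) - b')) :=
    (isSemialgebraicFunOn_aeval hs
      ((X (Fin.last 1) - C a') * (X (Fin.last 1) - C b') : MvPolynomial (Fin 2) ℚ)).congr
      fun z _ => by simp
  have h3 : IsSemialgebraicFunOn ℚ s (fun z => 2 * Real.sqrt (1 - z (Fin.last 1) ^ 2)) :=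
    (IsSemialgebraicFunOn.mul_holds (isSemialgebraicFunOn_natCast hs 2)
      (IsSemialgebraicFunOn.sqrt_holds (isSemialgebraicFunOn_aeval hs
        (1 - X (Fin.last 1) ^ 2 : MvPolynomial (Fin 2) ℚ)))).congr fun z _ => by simp
  exact (IsSemialgebraicFunOn.mul_holds h1 (h2.div h3 fun z hz => mul_ne_zero two_ne_zero
    (Real.sqrt_pos.2 (spreadPlaneReduce_radicand_pos ha hb (hsub z hz).1 (hsub z hz).2)).ne')).congr
    fun z _ => rfl

/-! ## The two Newton–Leibniz moves -/

/-- **The left piece is one Newton–Leibniz move away from zero** (for any representations `K_L`,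
`Z_L` with these domains and integrands): base `[-1, a']`, constant edges `a' ≤ b'`, primitive
`F (x, q) = 2√(1 − x²) · G(q)` with `∂F/∂q = 2√(1 − x²) · w(q)` on the open fibre `(a', b')`, and
boundary term `F (x, b') − F (x, a') = 0 = Z_L.integrand`.
[cite: KontsevichZagier2001, §1.2 rule (3)] -/
theorem spreadPlaneReduce_of_sub_of_mem_newtonLeibnizRel_left {a' b' : ℚ} (ha : -1 < a')
    (hab : a' < b') (hb : b' < 1) {w : ℝ → ℝ}
    (hGw : ∀ t ∈ Set.Ioo (a' : ℝ) b',
      HasDerivAt (fun q : ℝ => (q - a') * (q - b') / (2 * Real.sqrt (1 - q ^ 2))) (w t) t)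
    (KL : IntegralRep 2) (ZL : IntegralRep 1)
    (hLd : KL.domain = {z : Fin 2 → ℝ | (-1 ≤ z 0 ∧ z 0 ≤ a') ∧ ((a' : ℝ) ≤ z 1 ∧ z 1 ≤ b')})
    (hLi : KL.integrand = fun z => 2 * Real.sqrt (1 - z 0 ^ 2) * w (z 1))
    (hZd : ZL.domain = {x : Fin 1 → ℝ | -1 ≤ x 0 ∧ x 0 ≤ a'})
    (hZi : ZL.integrand = fun _ => 0) :
    of KL - of ZL ∈ newtonLeibnizRel := by
  have hab' : (a' : ℝ) ≤ b' := by exact_mod_cast hab.le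
  refine ⟨1, KL, ZL, fun _ => (a' : ℝ), fun _ => (b' : ℝ),
    fun z => 2 * Real.sqrt (1 - z 0 ^ 2) *
      ((z (Fin.last 1) - a') * (z (Fin.last 1) - b') / (2 * Real.sqrt (1 - z (Fin.last 1) ^ 2))),
    ?_, ?_, ?_, fun _ _ => hab', ?_, ?_, ?_, ?_, rfl⟩
  · -- the primitive is semialgebraic on the left piece (`a' ≤ q ≤ b'` there)
    refine spreadPlaneReduce_isSemialgebraicFunOn_prim ha hb KL.isSemialgebraic_domain
      fun z hz => ?_
    rw [hLd] at hz
    exact hz.2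
  · -- the lower edge `a'`
    exact (isSemialgebraicFunOn_aeval ZL.isSemialgebraic_domain
      (C a' : MvPolynomial (Fin 1) ℚ)).congr fun x _ => by simp
  · -- the upper edge `b'`
    exact (isSemialgebraicFunOn_aeval ZL.isSemialgebraic_domain
      (C b' : MvPolynomial (Fin 1) ℚ)).congr fun x _ => by simp
  · -- the left piece is the band with constant edges `a' ≤ q ≤ b'` over `[-1, a']`
    rw [hLd, hZd]
    ext z
    have e0 : Fin.init z 0 = z 0 := rfl
    have e1 : z (Fin.last 1) = z 1 := rfl
    simp only [mem_setOf_eq, e0, e1]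
  · -- continuity of `q ↦ F (x, q)` on the closed fibre `[a', b']`
    intro x _
    simp only [Fin.snoc_last, Fin.snoc_apply_zero]
    exact spreadPlaneReduce_continuousOn_profile ha hb _ le_rfl
  · -- `∂F/∂q = 2√(1 - x²) · w(q)` is the integrand on the open fibre
    intro x _ t ht
    simp only [Fin.snoc_last, Fin.snoc_apply_zero, hLi]
    exact (hGw t ht).const_mul _
  · -- the boundary term vanishes: `G(a') = G(b') = 0`
    intro x _
    simp only [Fin.snoc_last, Fin.snoc_apply_zero, hZi, sub_self, mul_zero, zero_mul, zero_div]

/-- **The right piece is one Newton–Leibniz move away from the segment stage** (for any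
representations `K_R`, `K_mid` with these domains and integrands): base `[a', b']`, edges
`x ≤ b'`, primitive `F (x, q) = 2√(1 − x²) · G(q)` with `∂F/∂q = 2√(1 − x²) · w(q)` on the open
fibre `(x, b') ⊆ (a', b')`, and boundary term
`F (x, b') − F (x, x) = −2√(1 − x²) G(x) = −(x − a')(x − b')` (the chord length cancels the
profile on the diagonal). [cite: KontsevichZagier2001, §1.2 rule (3)] -/
theorem spreadPlaneReduce_of_sub_of_mem_newtonLeibnizRel_right {a' b' : ℚ} (ha : -1 < a')
    (hb : b' < 1) {w : ℝ → ℝ}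
    (hGw : ∀ t ∈ Set.Ioo (a' : ℝ) b',
      HasDerivAt (fun q : ℝ => (q - a') * (q - b') / (2 * Real.sqrt (1 - q ^ 2))) (w t) t)
    (KR : IntegralRep 2) (Kmid : IntegralRep 1)
    (hRd : KR.domain = {z : Fin 2 → ℝ | ((a' : ℝ) ≤ z 0 ∧ z 0 ≤ b') ∧ z 0 ≤ z 1 ∧ z 1 ≤ b'})
    (hRi : KR.integrand = fun z => 2 * Real.sqrt (1 - z 0 ^ 2) * w (z 1))
    (hMd : Kmid.domain = {x : Fin 1 → ℝ | (a' : ℝ) ≤ x 0 ∧ x 0 ≤ b'})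
    (hMi : Kmid.integrand = fun x : Fin 1 → ℝ => -((x 0 - a') * (x 0 - b'))) :
    of KR - of Kmid ∈ newtonLeibnizRel := by
  refine ⟨1, KR, Kmid, fun x => x 0, fun _ => (b' : ℝ),
    fun z => 2 * Real.sqrt (1 - z 0 ^ 2) *
      ((z (Fin.last 1) - a') * (z (Fin.last 1) - b') / (2 * Real.sqrt (1 - z (Fin.last 1) ^ 2))),
    ?_, ?_, ?_, ?_, ?_, ?_, ?_, ?_, rfl⟩
  · -- the primitive is semialgebraic on the right piece (`a' ≤ x ≤ q ≤ b'` there)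
    refine spreadPlaneReduce_isSemialgebraicFunOn_prim ha hb KR.isSemialgebraic_domain
      fun z hz => ?_
    rw [hRd] at hz
    exact ⟨hz.1.1.trans hz.2.1, hz.2.2⟩
  · -- the lower edge `x`
    exact (isSemialgebraicFunOn_aeval Kmid.isSemialgebraic_domain
      (X 0 : MvPolynomial (Fin 1) ℚ)).congr fun x _ => by simp
  · -- the upper edge `b'`
    exact (isSemialgebraicFunOn_aeval Kmid.isSemialgebraic_domain
      (C b' : MvPolynomial (Fin 1) ℚ)).congr fun x _ => by simp
  · -- `x ≤ b'` on the base
    intro x hx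
    rw [hMd] at hx
    exact hx.2
  · -- the right piece is the band `{x ≤ q ≤ b'}` over `[a', b']`
    rw [hRd, hMd]
    ext z
    have e0 : Fin.init z 0 = z 0 := rfl
    have e1 : z (Fin.last 1) = z 1 := rfl
    simp only [mem_setOf_eq, e0, e1]
  · -- continuity of `q ↦ F (x, q)` on the closed fibre `[x, b']`
    intro x hx
    rw [hMd] at hx
    simp only [Fin.snoc_last, Fin.snoc_apply_zero]
    exact spreadPlaneReduce_continuousOn_profile ha hb _ hx.1
  · -- `∂F/∂q = 2√(1 - x²) · w(q)` is the integrand on the open fibre `(x, b') ⊆ (a', b')`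
    intro x hx t ht
    rw [hMd] at hx
    simp only [Fin.snoc_last, Fin.snoc_apply_zero, hRi]
    exact (hGw t ⟨hx.1.trans_lt ht.1, ht.2⟩).const_mul _
  · -- the boundary term: `0 − 2√(1 − x²) · (x − a')(x − b') / (2√(1 − x²)) = −(x − a')(x − b')`
    intro x hx
    rw [hMd] at hx
    simp only [Fin.snoc_last, Fin.snoc_apply_zero, hMi, sub_self, mul_zero, zero_div, zero_sub]
    have hs0 : Real.sqrt (1 - x 0 ^ 2) ≠ 0 :=
      (Real.sqrt_pos.2 (spreadPlaneReduce_radicand_pos ha hb hx.1 hx.2)).ne'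
    field_simp

/-! ## The reduction -/

/-- **The plane stage reduces to the segment stage**, for a general weight `w` which is the
derivative of the profile primitive `G(q) = (q − a')(q − b') / (2√(1 − q²))` on `(a', b')`: the
segment stage `K_mid = [[a', b'], −(x − a')(x − b')]` is equivalent to every representation of the
plane stage `[{(x, q) : -1 ≤ x ≤ q, a' ≤ q ≤ b'}, 2√(1 − x²) · w(q)]` — cut at `x = a'` (rule (1),
null overlap `{x = a'}`), the left piece is a relation and the right piece is one Newton–Leibniz
move away from `K_mid`. [folklore] -/
theorem spreadPlaneReduce_of_hasDerivAt {a' b' : ℚ} (ha : -1 < a') (hab : a' < b') (hb : b' < 1)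
    {w : ℝ → ℝ}
    (hGw : ∀ t ∈ Set.Ioo (a' : ℝ) b',
      HasDerivAt (fun q : ℝ => (q - a') * (q - b') / (2 * Real.sqrt (1 - q ^ 2))) (w t) t) :
    ∃ Kmid : IntegralRep 1,
      Kmid.domain = {x : Fin 1 → ℝ | ((a' : ℝ) ≤ x 0 ∧ x 0 ≤ b')} ∧
      (Kmid.integrand = fun x : Fin 1 → ℝ => -((x 0 - a') * (x 0 - b'))) ∧
      ∀ (K : IntegralRep 2),
        K.domain = {z : Fin 2 → ℝ | (-1 ≤ z 0 ∧ z 0 ≤ z 1) ∧ ((a' : ℝ) ≤ z 1 ∧ z 1 ≤ b')} →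
        (K.integrand = fun z => 2 * Real.sqrt (1 - z 0 ^ 2) * w (z 1)) →
        Equivalent K Kmid := by
  -- the segment stage `K_mid = [[a', b'], −(x − a')(x − b')]`
  obtain ⟨Kmid, hMd, hMi⟩ : ∃ Kmid : IntegralRep 1,
      Kmid.domain = {x : Fin 1 → ℝ | ((a' : ℝ) ≤ x 0 ∧ x 0 ≤ b')} ∧
      Kmid.integrand = fun x : Fin 1 → ℝ => -((x 0 - a') * (x 0 - b')) :=
    ⟨⟨{x : Fin 1 → ℝ | (a' : ℝ) ≤ x 0 ∧ x 0 ≤ b'}, fun x => -((x 0 - a') * (x 0 - b')),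
      isSemialgebraic_band a' b',
      (isSemialgebraicFunOn_aeval (isSemialgebraic_band a' b')
        (-((X 0 - C a') * (X 0 - C b')) : MvPolynomial (Fin 1) ℚ)).congr fun x _ => by simp,
      (Continuous.continuousOn (by fun_prop)).integrableOn_compact (isCompact_band (a' : ℝ) b')⟩,
      rfl, rfl⟩
  -- the zero representation on the base `[-1, a']` of the left piece
  obtain ⟨ZL, hZd, hZi⟩ : ∃ ZL : IntegralRep 1,
      ZL.domain = {x : Fin 1 → ℝ | -1 ≤ x 0 ∧ x 0 ≤ a'} ∧ ZL.integrand = fun _ => 0 :=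
    ⟨⟨{x : Fin 1 → ℝ | -1 ≤ x 0 ∧ x 0 ≤ a'}, fun _ => 0,
      spreadPlaneReduce_isSemialgebraic_leftBase a',
      (isSemialgebraicFunOn_natCast (spreadPlaneReduce_isSemialgebraic_leftBase a') 0).congr
        fun x _ => by simp,
      integrableOn_zero⟩, rfl, rfl⟩
  refine ⟨Kmid, hMd, hMi, fun K hKd hKi => ?_⟩
  have ha' : (-1 : ℝ) < (a' : ℝ) := by exact_mod_cast ha
  -- the two pieces of the cut at `x = a'`
  have hLsub : {z : Fin 2 → ℝ | (-1 ≤ z 0 ∧ z 0 ≤ a') ∧ ((a' : ℝ) ≤ z 1 ∧ z 1 ≤ b')} ⊆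
      K.domain := hKd ▸ fun z ⟨⟨h1, h2⟩, h3, h4⟩ => ⟨⟨h1, h2.trans h3⟩, h3, h4⟩
  have hRsub : {z : Fin 2 → ℝ | ((a' : ℝ) ≤ z 0 ∧ z 0 ≤ b') ∧ z 0 ≤ z 1 ∧ z 1 ≤ b'} ⊆
      K.domain := hKd ▸ fun z ⟨⟨h1, _⟩, h3, h4⟩ => ⟨⟨by linarith, h3⟩, h1.trans h3, h4⟩
  obtain ⟨KL, hLd, hLi⟩ : ∃ KL : IntegralRep 2,
      KL.domain = {z : Fin 2 → ℝ | (-1 ≤ z 0 ∧ z 0 ≤ a') ∧ ((a' : ℝ) ≤ z 1 ∧ z 1 ≤ b')} ∧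
      KL.integrand = K.integrand :=
    ⟨K.restrict _ (spreadPlaneReduce_isSemialgebraic_left a' b') hLsub, rfl, rfl⟩
  obtain ⟨KR, hRd, hRi⟩ : ∃ KR : IntegralRep 2,
      KR.domain = {z : Fin 2 → ℝ | ((a' : ℝ) ≤ z 0 ∧ z 0 ≤ b') ∧ z 0 ≤ z 1 ∧ z 1 ≤ b'} ∧
      KR.integrand = K.integrand :=
    ⟨K.restrict _ (spreadPlaneReduce_isSemialgebraic_right a' b') hRsub, rfl, rfl⟩
  -- rule (1): `[K] − [K_L] − [K_R]` is a domain-additivity relation (overlap in the null wall)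
  have h1 : of K - of KL - of KR ∈ relations := by
    refine domainAddRel_subset_relations ⟨2, K, KL, KR, ?_, ?_, ?_, ?_, rfl⟩
    · rw [hKd, hLd, hRd]
      ext z
      simp only [mem_union, mem_setOf_eq]
      constructor
      · rintro ⟨⟨h1, h2⟩, h3, h4⟩
        rcases le_total (z 0) a' with h | h
        · exact Or.inl ⟨⟨h1, h⟩, h3, h4⟩
        · exact Or.inr ⟨⟨h, h2.trans h4⟩, h2, h4⟩
      · rintro (⟨⟨h1, h2⟩, h3, h4⟩ | ⟨⟨h1, -⟩, h3, h4⟩)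
        · exact ⟨⟨h1, h2.trans h3⟩, h3, h4⟩
        · exact ⟨⟨by linarith, h3⟩, h1.trans h3, h4⟩
    · -- the overlap lies in the wall `{x = a'}`, a null coordinate hyperplane (Mathlib's
      -- `MeasureTheory.Measure.pi_hyperplane`)
      have hwall : volume {z : Fin 2 → ℝ | z 0 = (a' : ℝ)} = 0 := by
        rw [MeasureTheory.volume_pi]
        exact Measure.pi_hyperplane _ 0 _
      refine measure_mono_null (fun z hz => ?_) hwall
      rw [hLd, hRd] at hz
      exact le_antisymm hz.1.1.2 hz.2.1.1
    · exact fun z _ => by rw [hLi]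
    · exact fun z _ => by rw [hRi]
  -- rule (3) on the left piece, whose boundary term vanishes (`[Z_L]`, `[K_L]` are relations)
  have h2 : of KL - of ZL ∈ relations := newtonLeibnizRel_subset_relations
    (spreadPlaneReduce_of_sub_of_mem_newtonLeibnizRel_left ha hab hb hGw KL ZL hLd
      (hLi.trans hKi) hZd hZi)
  have h2' : of ZL ∈ relations := of_mem_relations_of_eqOn_zero ZL fun x _ => by simp [hZi]
  -- rule (3) on the right piece: `K_R ∼ K_mid`
  have h3 : of KR - of Kmid ∈ relations := newtonLeibnizRel_subset_relations
    (spreadPlaneReduce_of_sub_of_mem_newtonLeibnizRel_right ha hb hGw KR Kmid hRd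
      (hRi.trans hKi) hMd hMi)
  have key : of K - of Kmid =
      (of K - of KL - of KR) + ((of KL - of ZL) + of ZL) + (of KR - of Kmid) := by abel
  show of K - of Kmid ∈ relations
  rw [key]
  exact relations.add_mem (relations.add_mem h1 (relations.add_mem h2 h2')) h3

/-- **STUB `stub_spreadPlaneReduce`** (M) of the line `Sketch` (v6) — **the plane stage reduces to
the segment stage**: for `-1 < a' < b' < 1` there is a representation
`K_mid = [[a', b'], −(x − a')(x − b')]` of dimension `1` equivalent to every representation `K` of
the plane stage `[{(x, q) : -1 ≤ x ≤ q, a' ≤ q ≤ b'}, 2√(1 − x²) · h_{a',b'}(q)]` of the zero-mean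
spread weight `h_{a',b'} = 𝟙_{(a',b')} · G'`, `G(q) = (q − a')(q − b') / (2√(1 − q²))`
(`spreadPlaneReduce_of_hasDerivAt` with the calculus input `spreadPlaneReduce_hasDerivAt_profile`;
the admissibility hypotheses on `h_{a',b'}` are not needed for this step). [folklore] -/
theorem stub_spreadPlaneReduce : ∀ (a' b' : ℚ), -1 < a' → a' < b' → b' < 1 →
    IsSemialgebraicFunOn ℚ (Set.univ : Set (Fin 1 → ℝ))
        (fun x => (Set.Ioo (a' : ℝ) b').indicator (fun t => ((2 * t - (a' + b')) * (1 - t ^ 2) +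
          t * ((t - a') * (t - b'))) / (2 * (1 - t ^ 2) * Real.sqrt (1 - t ^ 2))) (x 0)) →
    ∀ (C : ℝ), (∀ t : ℝ, |(Set.Ioo (a' : ℝ) b').indicator (fun t => ((2 * t - (a' + b')) * (1 - t ^ 2) +
          t * ((t - a') * (t - b'))) / (2 * (1 - t ^ 2) * Real.sqrt (1 - t ^ 2))) t| ≤ C) →
    ∃ Kmid : IntegralRep 1,
      Kmid.domain = {x : Fin 1 → ℝ | ((a' : ℝ) ≤ x 0 ∧ x 0 ≤ b')} ∧
      (Kmid.integrand = fun x : Fin 1 → ℝ => -((x 0 - a') * (x 0 - b'))) ∧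
      ∀ (K : IntegralRep 2),
        K.domain = {z : Fin 2 → ℝ | (-1 ≤ z 0 ∧ z 0 ≤ z 1) ∧ ((a' : ℝ) ≤ z 1 ∧ z 1 ≤ b')} →
        (K.integrand = fun z => 2 * Real.sqrt (1 - z 0 ^ 2) *
          (Set.Ioo (a' : ℝ) b').indicator (fun t => ((2 * t - (a' + b')) * (1 - t ^ 2) +
            t * ((t - a') * (t - b'))) / (2 * (1 - t ^ 2) * Real.sqrt (1 - t ^ 2))) (z 1)) →
        Equivalent K Kmid := by
  intro a' b' ha hab hb _ _ _
  exact spreadPlaneReduce_of_hasDerivAt ha hab hb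
    (w := (Set.Ioo (a' : ℝ) b').indicator (fun t => ((2 * t - (a' + b')) * (1 - t ^ 2) +
      t * ((t - a') * (t - b'))) / (2 * (1 - t ^ 2) * Real.sqrt (1 - t ^ 2))))
    fun t ht => by
      rw [indicator_of_mem ht]
      exact spreadPlaneReduce_hasDerivAt_profile ha hb ht

end Summit.KontsevichZagierPeriods.KontsevichZagierPeriods.AyoubPiCancellationLine
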